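import Mathlib

/-!
# Tier4/Common/CompactUnimodular — Haar measures on a COMPACT group are right-invariant and inversion-invariant

Blind re-derivation cell `pub-hodge-repro`, Tier 4 «prove the step» (README §9–§10), seat t4-typer-2 (gen 3).
Target tree path `lean/Summits/Ventures/HodgeRepro/Tier4/Common/CompactUnimodular.lean`.  Mathlib only; no literature.

WHY.  The `(C, χ)`-projector `e_{C,χ} ψ (x) = ∫_C conj χ(κ) ψ(x κ) dν(κ)` of `Tier4/Common/KTypeProjector.lean` (the
«harmonic analysis on the compact tori» the L4 wall's `hvan` clause needs, L4-p1 KTypeTransport / L4-p2 S13576,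
S13737) averages over a compact subgroup `C` against a Haar probability measure `ν`; its adjoint identity needs
`∫ f(κ⁻¹) dν = ∫ f dν` and the projector identity needs `∫ f(κ g) dν = ∫ f dν` — i.e. that a Haar measure on the
compact group `C` is inversion-invariant and right-invariant.  Mathlib proves both only for COMMUTATIVE groups
(`IsHaarMeasure.isInvInvariant_of_regular`, `…_of_innerRegular`); the local tori of a general `PlaneData` need not be
commutative (only the row planes are, RowTorus `torusT_ofLinesRow_comm`).  Here both are proved for every compact
group: the modular character `Δ` (Mathlib `modularCharacterFun`, `map (· * g) μ = Δ(g) • μ`) is `1` on a compact group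
by comparing total masses (`0 < μ(H) < ∞`), and `μ.inv` is then a left Haar measure of the same total mass, hence
`= μ` by uniqueness (`isMulLeftInvariant_eq_smul_of_innerRegular`; Haar measures on a compact space are inner regular).

* `modularCharacterFun_eq_one_of_compactSpace` — `Δ ≡ 1` on a compact group;
* **`isMulRightInvariant_of_compactSpace`** — a Haar measure on a compact group is right-invariant (unimodularity);
* **`isInvInvariant_of_compactSpace`** — a Haar measure on a compact group is inversion-invariant;
* `integral_mul_right_eq_self_of_compactSpace`, `integral_inv_eq_self_of_compactSpace`,
  `integral_mul_inv_right_eq_self_of_compactSpace` — the integral forms used by the projector;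
* `compactSpace_subgroup_of_isCompact` — a compact subgroup is a compact space (the bridge from
  `IsCompact (C : Set G)` to the typeclass the above need).

Nothing here says anything about the status of the Hodge conjecture for CM abelian varieties, which is NOT proved
(HC_CM is NOT proved by anyone in this repository).
-/

set_option autoImplicit false

noncomputable section

namespace Summit.Ventures.HodgeRepro.Tier4.Common

open MeasureTheory Measure Topology Set
open scoped ENNReal NNReal

section Compact

variable {H : Type*} [Group H] [TopologicalSpace H] [IsTopologicalGroup H] [CompactSpace H]
  [MeasurableSpace H] [BorelSpace H]

/-- **The modular character of a compact group is trivial**: `map (· * g) μ = Δ(g) • μ` (Mathlib) and both sides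
have the same total mass `μ(H) ∈ (0, ∞)`. -/
theorem modularCharacterFun_eq_one_of_compactSpace (g : H) : modularCharacterFun g = 1 := by
  let μ : Measure H := MeasureTheory.Measure.haar
  have hmap : map (· * g) μ = modularCharacterFun g • μ := map_right_mul_eq_modularCharacterFun_smul μ g
  have h1 : (map (· * g) μ) univ = μ univ := by
    rw [map_apply (measurable_mul_const g) MeasurableSet.univ, preimage_univ]
  rw [hmap, Measure.smul_apply, ENNReal.smul_def] at h1
  have h0 : μ univ ≠ 0 := (isOpen_univ.measure_pos μ univ_nonempty).ne'
  have htop : μ univ ≠ ⊤ := measure_ne_top μ univ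
  have hcoe : ((modularCharacterFun g : ℝ≥0) : ℝ≥0∞) = 1 :=
    (ENNReal.mul_left_inj h0 htop).1 (by rw [one_mul]; exact h1)
  exact_mod_cast hcoe

/-- **Compact groups are unimodular**: every Haar measure on a compact group is right-invariant. -/
theorem isMulRightInvariant_of_compactSpace (ν : Measure H) [ν.IsHaarMeasure] : ν.IsMulRightInvariant := by
  refine ⟨fun g => ?_⟩
  rw [map_right_mul_eq_modularCharacterFun_smul ν g, modularCharacterFun_eq_one_of_compactSpace g, one_smul]

/-- **Haar measures on a compact group are inversion-invariant**: `ν.inv` is a left Haar measure (`ν` being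
right-invariant) of the same total mass, hence `= ν` by uniqueness. -/
theorem isInvInvariant_of_compactSpace (ν : Measure H) [ν.IsHaarMeasure] : ν.IsInvInvariant := by
  haveI := isMulRightInvariant_of_compactSpace ν
  constructor
  have hc : ν.inv = haarScalarFactor ν.inv ν • ν := isMulLeftInvariant_eq_smul_of_innerRegular ν.inv ν
  have h1 : ν.inv univ = ν univ := by rw [inv_apply, Set.inv_univ]
  rw [hc, Measure.smul_apply, ENNReal.smul_def] at h1
  have h0 : ν univ ≠ 0 := (isOpen_univ.measure_pos ν univ_nonempty).ne'
  have htop : ν univ ≠ ⊤ := measure_ne_top ν univ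
  have hcoe : ((haarScalarFactor ν.inv ν : ℝ≥0) : ℝ≥0∞) = 1 :=
    (ENNReal.mul_left_inj h0 htop).1 (by rw [one_mul]; exact h1)
  have hone : haarScalarFactor ν.inv ν = 1 := by exact_mod_cast hcoe
  rw [hc, hone, one_smul]

variable {E : Type*} [NormedAddCommGroup E] [NormedSpace ℝ E]

/-- Right translation invariance of the Haar integral on a compact group. -/
theorem integral_mul_right_eq_self_of_compactSpace (ν : Measure H) [ν.IsHaarMeasure] (f : H → E) (g : H) :
    ∫ x, f (x * g) ∂ν = ∫ x, f x ∂ν := by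
  haveI := isMulRightInvariant_of_compactSpace ν
  exact integral_mul_right_eq_self f g

/-- Inversion invariance of the Haar integral on a compact group. -/
theorem integral_inv_eq_self_of_compactSpace (ν : Measure H) [ν.IsHaarMeasure] (f : H → E) :
    ∫ x, f x⁻¹ ∂ν = ∫ x, f x ∂ν := by
  haveI := isInvInvariant_of_compactSpace ν
  exact integral_inv_eq_self f ν

/-- `∫ f(g x⁻¹) dν = ∫ f dν` on a compact group (left translate of the inverse). -/
theorem integral_mul_inv_right_eq_self_of_compactSpace (ν : Measure H) [ν.IsHaarMeasure] (f : H → E) (g : H) :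
    ∫ x, f (g * x⁻¹) ∂ν = ∫ x, f x ∂ν := by
  rw [integral_inv_eq_self_of_compactSpace ν (fun x => f (g * x))]
  exact integral_mul_left_eq_self f g

end Compact

section Subgroup

variable {G : Type*} [Group G] [TopologicalSpace G]

/-- A compact subgroup, as a subtype, is a compact space (the typeclass the section above needs). -/
theorem compactSpace_subgroup_of_isCompact (C : Subgroup G) (hC : IsCompact (C : Set G)) : CompactSpace C :=
  isCompact_iff_compactSpace.1 hC

end Subgroup

end Summit.Ventures.HodgeRepro.Tier4.Common

end
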